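import Summits.ValiantsHypothesis.ValiantsHypothesis.Theorems.KPlusLogSqLawTropicalBCoupledRegisters
import Summits.ValiantsHypothesis.ValiantsHypothesis.Theorems.KPlusLogSqLawTropicalBStaticPadding
import Summits.ValiantsHypothesis.ValiantsHypothesis.Theorems.KPlusLogSqLawTropicalBPadding

/-!
# Route `KPlusLogSqLaw`, crux `TropicalB` — the coupled-register row at EVERY size: `S(M, 3) ≥ ⌊(M−1)/2⌋² + 2⌊(M−1)/2⌋`

HONEST FRAMING.  Helper toward the registered stubs of the crux `TropicalB` (ledger item `stmt-ValiantsHypothesis-19771`, route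
`KPlusLogSqLaw`; cell `pub-symmetroid`, seat val-sym-trop-p5 (g3), 2026-08-26).  One-line corollaries of the coupled-register family
(`…TropicalBCoupledRegisters`: `TropRootLawAtStatic (2N+1) 3 B → N² + 2N ≤ B`) and the size paddings of the tree
(`TropicalCensus.tropRootLawAtStatic_of_le_size`, val-sym-trop-p4; `tropRootLawAt_of_le`, …TropicalBPadding): the lower bound at
every size `M` and every `K ≥ 3`, static and general.  A `K = 3` census row (quadratic, as counting predicts); nothing is asserted
about `TropicalB` in its window, `WeakLifting`, `KPlusLogSqLaw`, `MatrixDescartes` (stmt-ValiantsHypothesis-18050) or VP ≠ VNP.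

* `sq_le_of_tropRootLawAtStatic_three_ge` — `2N+1 ≤ M → TropRootLawAtStatic M 3 B → N² + 2N ≤ B`;
* `coupledRegister_static_row` — `TropRootLawAtStatic M 3 B → ⌊(M−1)/2⌋·⌊(M−1)/2⌋ + 2·⌊(M−1)/2⌋ ≤ B` for every `M`
  (`≈ M²/4`; the tree's previous static `K = 3` row, `…TropicalBStaticThree`, is `C(⌊M/3⌋+2, 2) − 2 ≈ M²/18`; slope counting caps the
  row at `C(M+2,2) − 1 ≈ M²/2`);
* `coupledRegister_row` — the same for the general row `TropRootLawAt M K B`, every `K ≥ 3` (class padding).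
[folklore] (padding bookkeeping).
-/

set_option linter.dupNamespace false
set_option autoImplicit false

namespace Summit.ValiantsHypothesis.ValiantsHypothesis.Theorems.KPlusLogSqLaw

open Summit.ValiantsHypothesis.ValiantsHypothesis.Theorems.LacunarySymmetroidMatrixDescartes.TropicalCensus

/-- the coupled-register bound at every size `M ≥ 2N+1` (static row). -/
theorem sq_le_of_tropRootLawAtStatic_three_ge (N M : ℕ) {B : ℕ} (hM : 2 * N + 1 ≤ M) (h : TropRootLawAtStatic M 3 B) :
    N * N + 2 * N ≤ B :=
  sq_le_of_tropRootLawAtStatic_coupledRegister N (tropRootLawAtStatic_of_le_size hM h)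

/-- **Static `K = 3` row at every size**: `TropRootLawAtStatic M 3 B → ⌊(M−1)/2⌋² + 2⌊(M−1)/2⌋ ≤ B`. -/
theorem coupledRegister_static_row (M : ℕ) {B : ℕ} (h : TropRootLawAtStatic M 3 B) :
    (M - 1) / 2 * ((M - 1) / 2) + 2 * ((M - 1) / 2) ≤ B := by
  rcases Nat.eq_zero_or_pos M with rfl | hM
  · simp
  · exact sq_le_of_tropRootLawAtStatic_three_ge ((M - 1) / 2) M (by omega) h

/-- **General row at every size and every `K ≥ 3`**: `TropRootLawAt M K B → ⌊(M−1)/2⌋² + 2⌊(M−1)/2⌋ ≤ B`. -/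
theorem coupledRegister_row (M K : ℕ) {B : ℕ} (hK : 3 ≤ K) (h : TropRootLawAt M K B) :
    (M - 1) / 2 * ((M - 1) / 2) + 2 * ((M - 1) / 2) ≤ B := by
  rcases Nat.eq_zero_or_pos M with rfl | hM
  · simp
  · exact sq_le_of_tropRootLawAt_coupledRegister ((M - 1) / 2) (tropRootLawAt_of_le (by omega) hK h)

end Summit.ValiantsHypothesis.ValiantsHypothesis.Theorems.KPlusLogSqLaw
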